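import Summits.BirchSwinnertonDyer.BirchSwinnertonDyer.Theorems.ByReductionTypeAtTwoMultTowerNS2TwistedTateAlgebra
import Literature.NumberTheory.EllipticCurves.Sha
import HarnessLib

/-!
# Route `ByReductionTypeAtTwo`, crux `MultUpperHalfAtTwo` (item stmt-BirchSwinnertonDyer-19922), TOWER road, the
# «ONE BIT AT A NON-SPLIT 2» rows: KERNEL BRICK 18 — transport along Tate's twisted uniformisation:
# `M_∞ = E(K̄_v)^{H_∞} = Ψ(T)`, `T = {x ∈ (K̄_v^{H_∞ ∩ Stab t})ˣ : τ₀x·x ∈ q^ℤ}`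

HONEST FRAMING (cell `bsd-2adic`, run/shared/lean/pub/bsd-2adic/, seat `bsd-2adic-tower-1` GEN 9, HUMAN RULINGS
D-0036 / D-0054 / D-0074): TOOL theorems only (no definition, no named fact, no `sorry`); closes nothing by itself;
nothing booked; BSD is not proved by any of this. Module M7 (step S1 of the scope memo
HOME/tower/SCOPE-hNS2one-kernel-GEN8.md) of the KERNELISATION of the MEMO binder
`MultTowerNS2.localTowerKerTwoTorsion_le_two_nonsplitTwo_of_tateUnit`. The hypotheses `hker` / `hequiv` are the kernel
and the (value form of the) twisted equivariance delivered by `TateCurve.exists_twistedTateUniformisation_tateJ`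
(`Ψ : K̄_vˣ → E(K̄_v)`, kernel `q^ℤ`, `σΨ(u) = χ(σ)Ψ(σu)`, `χ(σ) = 1 ⇔ σ t = t`); `τ₀ ∈ H_∞` is a flip of `t` (BRICK 10).

* `smul_eq_self_of_smul_eq_zpow_mul` — orbit finiteness: `h x = Q^j x`, `hQ = Q`, `Q` of infinite order ⇒ `h x = x`;
* `tatePsi_eq_iff` — `Ψ(a) = Ψ(b) ⇔ a ∈ q^ℤ b`;
* `exists_unit_of_mem_fixedPoints` — `M_∞ ⊆ Ψ(T)`; `apply_mem_fixedPoints` — `Ψ(T) ⊆ M_∞`.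

References: R. Greenberg, LNM 1716 (1999), §3 pp. 87–93; J. Silverman, GTM 151, Thm. V.3.1, Lemma V.5.2, Thm. V.5.3.
-/

set_option autoImplicit false
-- the Theorems namespace of this sub repeats the summit name by design (D-0017 nested layout: Summit.<S>.<Sub>)
set_option linter.dupNamespace false

noncomputable section

open scoped Classical

namespace Summit.BirchSwinnertonDyer.BirchSwinnertonDyer.Theorems.MultTowerNS2

open NumberField IsDedekindDomain Field Literature.NumberTheory.EllipticCurves
  Literature.NumberTheory.GaloisRepresentations

variable {κ : ZpExtension ℚ 2}

/-! ### An orbit-finiteness lemma -/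

/-- **If `h x = Q^j x` with `h Q = Q` and `Q` of infinite order, then `h x = x`.** The `h`-orbit of the algebraic
element `x` lies in the root set of its minimal polynomial, so `h^d x = x` for some `d ≥ 1`, while
`h^d x = Q^{jd} x`; hence `Q^{jd} = 1`, `j = 0`. [folklore] -/
theorem smul_eq_self_of_smul_eq_zpow_mul (v : HeightOneSpectrum (𝓞 ℚ))
    {h : absoluteGaloisGroup (v.adicCompletion ℚ)} {Q x : AlgebraicClosure (v.adicCompletion ℚ)}
    (hQfix : h • Q = Q) (hQ0 : Q ≠ 0) (hQtor : ∀ j : ℤ, Q ^ j = 1 → j = 0) (hx0 : x ≠ 0) {j : ℤ}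
    (hj : h • x = Q ^ j * x) : h • x = x := by
  -- `h^m x = Q^{jm} x`
  have hpow : ∀ m : ℕ, (h ^ m) • x = Q ^ (j * m) * x := fun m ↦ by
    induction m with
    | zero => simp
    | succ m ih =>
      rw [pow_succ', mul_smul, ih, smul_mul', smul_zpow₀', hQfix, hj, ← mul_assoc, ← zpow_add₀ hQ0]
      push_cast
      ring_nf
  -- the orbit lies in the (finite) root set of the minimal polynomial
  have hint : IsIntegral (v.adicCompletion ℚ) x := Algebra.IsIntegral.isIntegral x
  have hmem : ∀ m : ℕ, (h ^ m) • x ∈ (minpoly (v.adicCompletion ℚ) x).rootSet (AlgebraicClosure (v.adicCompletion ℚ)) :=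
    fun m ↦ by
      rw [Polynomial.mem_rootSet]
      refine ⟨minpoly.ne_zero hint, ?_⟩
      have e1 := Polynomial.aeval_algHom_apply
        ((absoluteGaloisGroup.toAlgEquiv (v.adicCompletion ℚ) (h ^ m) :
          AlgebraicClosure (v.adicCompletion ℚ) ≃ₐ[v.adicCompletion ℚ] AlgebraicClosure (v.adicCompletion ℚ)) :
          AlgebraicClosure (v.adicCompletion ℚ) →ₐ[v.adicCompletion ℚ] AlgebraicClosure (v.adicCompletion ℚ))
        x (minpoly (v.adicCompletion ℚ) x)
      rw [minpoly.aeval, map_zero] at e1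
      exact e1
  let f : ℕ → (minpoly (v.adicCompletion ℚ) x).rootSet (AlgebraicClosure (v.adicCompletion ℚ)) :=
    fun m ↦ ⟨(h ^ m) • x, hmem m⟩
  obtain ⟨m₁, m₂, hne, heq⟩ := Finite.exists_ne_map_eq_of_infinite f
  have heq' : (h ^ m₁) • x = (h ^ m₂) • x := congrArg Subtype.val heq
  -- `h^d x = x` with `d ≥ 1` forces `j = 0`
  have key : ∀ {a b : ℕ}, a < b → (h ^ a) • x = (h ^ b) • x → h • x = x := by
    intro a b hab hab'
    obtain ⟨d, rfl⟩ := Nat.exists_eq_add_of_lt hab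
    rw [show a + d + 1 = a + (d + 1) by ring, pow_add, mul_smul] at hab'
    have h1 : x = (h ^ (d + 1)) • x := smul_left_cancel _ hab'
    rw [hpow] at h1
    have h2 : Q ^ (j * (d + 1 : ℕ)) = 1 := by
      have h3 : Q ^ (j * (d + 1 : ℕ)) * x = 1 * x := by rw [one_mul]; exact h1.symm
      exact mul_right_cancel₀ hx0 h3
    have h4 := hQtor _ h2
    have hj0 : j = 0 := by
      rcases mul_eq_zero.mp h4 with h5 | h5
      · exact h5
      · exfalso; push_cast at h5; omega
    rw [hj, hj0, zpow_zero, one_mul]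
  rcases lt_or_gt_of_ne hne with hlt | hlt
  · exact key hlt heq'
  · exact key hlt heq'.symm

/-! ### The twisted Tate module: `M_∞ = Ψ(T)` -/

/-- **Two units have the same image under the Tate uniformisation iff they differ by a power of `q`** (kernel `q^ℤ`).
[cite: SilvermanATAEC1994, Thm. V.3.1 (c),(d) (PDF p. 395)] -/
theorem tatePsi_eq_iff (v : HeightOneSpectrum (𝓞 ℚ)) {W : WeierstrassCurve ℚ}
    {Ψ : Additive (AlgebraicClosure (v.adicCompletion ℚ))ˣ →+ localPoints W (v.adicCompletion ℚ)}
    {Q : AlgebraicClosure (v.adicCompletion ℚ)}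
    (hker : ∀ u : (AlgebraicClosure (v.adicCompletion ℚ))ˣ, Ψ (Additive.ofMul u) = 0 ↔
      ∃ j : ℤ, (u : AlgebraicClosure (v.adicCompletion ℚ)) = Q ^ j)
    (a b : (AlgebraicClosure (v.adicCompletion ℚ))ˣ) :
    Ψ (Additive.ofMul a) = Ψ (Additive.ofMul b) ↔
      ∃ j : ℤ, (a : AlgebraicClosure (v.adicCompletion ℚ)) = Q ^ j * (b : AlgebraicClosure (v.adicCompletion ℚ)) := by
  have hb := b.ne_zero
  rw [← sub_eq_zero, sub_eq_add_neg, ← map_neg, ← ofMul_inv, ← map_add, ← ofMul_mul, hker]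
  simp only [Units.val_mul, Units.val_inv_eq_inv_val]
  constructor
  · rintro ⟨j, hj⟩
    exact ⟨j, by rw [← hj]; field_simp⟩
  · rintro ⟨j, hj⟩
    exact ⟨j, by rw [hj]; field_simp⟩

section Transport

variable (v : HeightOneSpectrum (𝓞 ℚ)) {W : WeierstrassCurve ℚ}
  {Ψ : Additive (AlgebraicClosure (v.adicCompletion ℚ))ˣ →+ localPoints W (v.adicCompletion ℚ)}
  {t Q : AlgebraicClosure (v.adicCompletion ℚ)} {τ₀ : absoluteGaloisGroup (v.adicCompletion ℚ)}

/-- **`M_∞ ⊆ Ψ(T)`**: a point of `E(K̄_v)` fixed by `H_∞` is `Ψ(x)` with `x` fixed by `H_∞ ∩ Stab(t)` and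
`τ₀x · x ∈ q^ℤ` (`τ₀ ∈ H_∞` a flip of `t`). For `h ∈ H_∞ ∩ Stab(t)`: `Ψ(x) = hΨ(x) = Ψ(hx)`, so `hx = q^j x`,
and `hx = x` by orbit finiteness; for the flip: `Ψ(x) = τ₀Ψ(x) = −Ψ(τ₀x)`, so `Ψ(x·τ₀x) = 0`.
[cite: GreenbergLNM1716, §3 (pp. 87–93)] [cite: SilvermanATAEC1994, Lemma V.5.2 (c), Thm. V.5.3] -/
theorem exists_unit_of_mem_fixedPoints (hsurj : Function.Surjective Ψ)
    (hker : ∀ u : (AlgebraicClosure (v.adicCompletion ℚ))ˣ, Ψ (Additive.ofMul u) = 0 ↔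
      ∃ j : ℤ, (u : AlgebraicClosure (v.adicCompletion ℚ)) = Q ^ j)
    (hequiv : ∀ (σ : absoluteGaloisGroup (v.adicCompletion ℚ)) (u u' : (AlgebraicClosure (v.adicCompletion ℚ))ˣ),
      (u' : AlgebraicClosure (v.adicCompletion ℚ)) = σ • (u : AlgebraicClosure (v.adicCompletion ℚ)) →
        σ • Ψ (Additive.ofMul u) = (if σ • t = t then (1 : ℤ) else -1) • Ψ (Additive.ofMul u'))
    (hQfix : ∀ σ : absoluteGaloisGroup (v.adicCompletion ℚ), σ • Q = Q) (hQ0 : Q ≠ 0)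
    (hQtor : ∀ j : ℤ, Q ^ j = 1 → j = 0) (hne : -t ≠ t)
    (hτ₀ : τ₀ ∈ localSubgroup κ.kerSubgroup (v.adicCompletion ℚ)) (hτ₀t : τ₀ • t = -t)
    {m : localPoints W (v.adicCompletion ℚ)}
    (hm : ∀ h ∈ localSubgroup κ.kerSubgroup (v.adicCompletion ℚ), h • m = m) :
    ∃ x : (AlgebraicClosure (v.adicCompletion ℚ))ˣ, Ψ (Additive.ofMul x) = m ∧
      (∀ h ∈ localSubgroup κ.kerSubgroup (v.adicCompletion ℚ), h • t = t →
        h • (x : AlgebraicClosure (v.adicCompletion ℚ)) = x) ∧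
      ∃ a : ℤ, τ₀ • (x : AlgebraicClosure (v.adicCompletion ℚ)) * x = Q ^ a := by
  obtain ⟨x', hx'⟩ := hsurj m
  set x : (AlgebraicClosure (v.adicCompletion ℚ))ˣ := Additive.toMul x' with hx
  have hxm : Ψ (Additive.ofMul x) = m := by rw [hx, ofMul_toMul]; exact hx'
  refine ⟨x, hxm, fun h hh hht ↦ ?_, ?_⟩
  · -- `h ∈ H_∞ ∩ Stab(t)`
    set u' : (AlgebraicClosure (v.adicCompletion ℚ))ˣ :=
      Units.mk0 (h • (x : AlgebraicClosure (v.adicCompletion ℚ))) ((smul_ne_zero_iff_ne h).mpr x.ne_zero) with hu'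
    have h1 := hequiv h x u' rfl
    rw [if_pos hht, one_zsmul, hxm, hm h hh] at h1
    -- `Ψ x = Ψ (h x)`: `h x = Q^j x`
    rw [← hxm, tatePsi_eq_iff v hker] at h1
    obtain ⟨j, hj⟩ := h1
    have hj' : h • (x : AlgebraicClosure (v.adicCompletion ℚ)) = Q ^ (-j) * x := by
      rw [zpow_neg, ← Units.val_mk0 ((smul_ne_zero_iff_ne h).mpr x.ne_zero), ← hu', hj]
      field_simp
    exact smul_eq_self_of_smul_eq_zpow_mul v (hQfix h) hQ0 hQtor x.ne_zero hj'
  · -- the flip `τ₀`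
    set u' : (AlgebraicClosure (v.adicCompletion ℚ))ˣ :=
      Units.mk0 (τ₀ • (x : AlgebraicClosure (v.adicCompletion ℚ))) ((smul_ne_zero_iff_ne τ₀).mpr x.ne_zero) with hu'
    have h1 := hequiv τ₀ x u' rfl
    rw [if_neg (fun h' ↦ hne (hτ₀t.symm.trans h')), neg_one_zsmul, hxm, hm τ₀ hτ₀] at h1
    -- `Ψ x = -Ψ (τ₀ x)`: `Ψ (τ₀x · x) = 0`
    have h2 : Ψ (Additive.ofMul (u' * x)) = 0 := by rw [ofMul_mul, map_add, hxm, h1, add_neg_cancel]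
    obtain ⟨a, ha⟩ := (hker _).mp h2
    exact ⟨a, by rw [← ha, Units.val_mul, hu', Units.val_mk0]⟩

/-- **`Ψ(T) ⊆ M_∞`**: if `x` is fixed by `H_∞ ∩ Stab(t)` and `τ₀x · x = Q^a`, then `Ψ(x)` is fixed by `H_∞` (an element
of `H_∞` either fixes `t`, or flips it and then acts on `x` like `τ₀`: `hΨ(x) = −Ψ(τ₀x) = −Ψ(Q^a/x) = Ψ(x)`).
[cite: GreenbergLNM1716, §3 (pp. 87–93)] [cite: SilvermanATAEC1994, Lemma V.5.2 (c), Thm. V.5.3] -/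
theorem apply_mem_fixedPoints
    (hker : ∀ u : (AlgebraicClosure (v.adicCompletion ℚ))ˣ, Ψ (Additive.ofMul u) = 0 ↔
      ∃ j : ℤ, (u : AlgebraicClosure (v.adicCompletion ℚ)) = Q ^ j)
    (hequiv : ∀ (σ : absoluteGaloisGroup (v.adicCompletion ℚ)) (u u' : (AlgebraicClosure (v.adicCompletion ℚ))ˣ),
      (u' : AlgebraicClosure (v.adicCompletion ℚ)) = σ • (u : AlgebraicClosure (v.adicCompletion ℚ)) →
        σ • Ψ (Additive.ofMul u) = (if σ • t = t then (1 : ℤ) else -1) • Ψ (Additive.ofMul u'))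
    (ht : ∀ σ : absoluteGaloisGroup (v.adicCompletion ℚ), σ • t = t ∨ σ • t = -t) (hne : -t ≠ t)
    (hτ₀ : τ₀ ∈ localSubgroup κ.kerSubgroup (v.adicCompletion ℚ)) (hτ₀t : τ₀ • t = -t)
    {x : (AlgebraicClosure (v.adicCompletion ℚ))ˣ}
    (hxL : ∀ h ∈ localSubgroup κ.kerSubgroup (v.adicCompletion ℚ), h • t = t →
      h • (x : AlgebraicClosure (v.adicCompletion ℚ)) = x)
    {a : ℤ} (hxa : τ₀ • (x : AlgebraicClosure (v.adicCompletion ℚ)) * x = Q ^ a) :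
    ∀ h ∈ localSubgroup κ.kerSubgroup (v.adicCompletion ℚ), h • Ψ (Additive.ofMul x) = Ψ (Additive.ofMul x) := by
  intro h hh
  rcases ht h with hht | hht
  · have h1 := hequiv h x x (hxL h hh hht).symm
    rw [if_pos hht, one_zsmul] at h1
    exact h1
  · set u' : (AlgebraicClosure (v.adicCompletion ℚ))ˣ :=
      Units.mk0 (h • (x : AlgebraicClosure (v.adicCompletion ℚ))) ((smul_ne_zero_iff_ne h).mpr x.ne_zero) with hu'
    have h1 := hequiv h x u' rfl
    rw [if_neg (fun h' ↦ hne (hht.symm.trans h')), neg_one_zsmul] at h1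
    -- `h x = τ₀ x = Q^a x⁻¹`, so `Ψ (h x) = Ψ (x⁻¹) = -Ψ x`
    have h2 : Ψ (Additive.ofMul u') = Ψ (Additive.ofMul x⁻¹) := by
      rw [tatePsi_eq_iff v hker]
      refine ⟨a, ?_⟩
      rw [hu', Units.val_mk0, Units.val_inv_eq_inv_val, flip_smul_eq hτ₀ hτ₀t hh hht hxL, ← hxa]
      field_simp
    rw [h1, h2, ofMul_inv, map_neg, neg_neg]

end Transport

end Summit.BirchSwinnertonDyer.BirchSwinnertonDyer.Theorems.MultTowerNS2

end
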